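import Summits.Ventures.HodgeRepro2.T5RecordSatakeRecurrence
import Summits.Ventures.HodgeRepro2.T5RecordSatakeDegree
import Summits.Ventures.HodgeRepro2.T5RecordSatakeRecurrenceIntrinsic
import Summits.Ventures.HodgeRepro2.T5InertDegreePrinted

/-!
# The degrees of all the cells on the record's own pair: `deg Tₙ = (N(v)³ + 1) N(v)^{4n−3}`, `deg T₀ = 1`

Tier-5 support N3 / §G-N4.2 (seat p3, gen 78). File 247 produces the cells `gₙ ∈ U(1 ⊗ H)` of the record's pair
(`gₙ ↦ P · diag(ϖⁿ, 1, ϖ⁻ⁿ) · P⁻¹` in `U(H_w)`) and their tree recursion; file 244 computes the degree of `g₁`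
only. This file carries file 207's count `#(K aₙ K / K) = (N(v)³ + 1) N(v)^{4n−3}` (`n ≥ 1`, file 203's row 11) and
`#(K a₀ K / K) = 1` along the same two isomorphisms for EVERY cell — row 11 of T5-SATAKE-KERNEL-p3.md as printed on
the record's own pair:

* **`ncard_orbit_record_of_coe_eq`** — any `g ∈ U(1 ⊗ H)` whose image in `U(H_w)` is `P · cell(ϖ', n) · P⁻¹`
  (`n ≥ 1`) has `#(K_v g K_v / K_v) = (N(v)³ + 1) N(v)^{4n−3}`; `ncard_orbit_record_of_coe_eq_zero` — `n = 0`;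
* **`exists_cells_three_term_and_ncard_record`** — file 247's cells with their degrees: `deg Tₙ = (N(v)³ + 1)
  N(v)^{4n−3}` for `n ≥ 1`, `deg T₀ = 1`, and the recursion `T₁ T_{n+2} = T_{n+3} + (N(v) − 1) T_{n+2} + N(v)⁴
  T_{n+1}`, `T₁² = T₂ + (N(v) − 1) T₁ + (N(v)⁴ + N(v)) T₀`;
* **`exists_cells_three_term_and_ncard_record_of_staysPrime`** / **`…_of_staysPrime'`** — at every place of `K⁺`
  that stays prime in `K` and is good for `H`, with and without the auxiliary datum `(θ, y)` (file 248's method).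

§8(d): uses an L-value-free non-vanishing device: NO.
-/

open Matrix NumberField NumberField.IsCMField IsDedekindDomain IsDedekindDomain.HeightOneSpectrum Module Polynomial
  MulAction
open scoped TensorProduct Pointwise
open Summit.Ventures.HodgeRepro2.T5UnitaryGroupForm Summit.Ventures.HodgeRepro2.T5UnitaryHeckeAdjoint
  Summit.Ventures.HodgeRepro2.T5HeckePermutationModule Summit.Ventures.HodgeRepro2.T5StarOfInvolution
  Summit.Ventures.HodgeRepro2.T5FinitePlaceCM Summit.Ventures.HodgeRepro2.T5FinitePlaceNormIndex
  Summit.Ventures.HodgeRepro2.T5NonSplitPlaceUnitaryGroup Summit.Ventures.HodgeRepro2.T5RecordHyperspecial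
  Summit.Ventures.HodgeRepro2.T5GlobalLatticeAlmostAll Summit.Ventures.HodgeRepro2.T5HermitianLocalIsotropyN3
  Summit.Ventures.HodgeRepro2.T5FinitePlaceSplitClassification Summit.Ventures.HodgeRepro2.T5HermitianThreeElements
  Summit.Ventures.HodgeRepro2.T5GaloisCartanThree Summit.Ventures.HodgeRepro2.T5InertDegreeGalois
  Summit.Ventures.HodgeRepro2.T5InertDegreeCompletion Summit.Ventures.HodgeRepro2.T5InertPlaceCompletion
  Summit.Ventures.HodgeRepro2.T5InertDegreeAdicCompletion Summit.Ventures.HodgeRepro2.T5InertSatakeTransform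
  Summit.Ventures.HodgeRepro2.T5InertPlaceCompletionCells Summit.Ventures.HodgeRepro2.T5InertTopCoefficient
  Summit.Ventures.HodgeRepro2.T5SplitUnitaryGroupEquiv Summit.Ventures.HodgeRepro2.T5HeckeBasisCells
  Summit.Ventures.HodgeRepro2.T5HeckeDoubleCoset Summit.Ventures.HodgeRepro2.T5InertHeckeCells
  Summit.Ventures.HodgeRepro2.T5HeckeGeneratorTransport Summit.Ventures.HodgeRepro2.T5RecordSatake
  Summit.Ventures.HodgeRepro2.T5CartanCellsDistinct Summit.Ventures.HodgeRepro2.T5HeckeIsomorphismTransport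
  Summit.Ventures.HodgeRepro2.T5HeckeIsomorphismTransportCells Summit.Ventures.HodgeRepro2.T5SplitPlaceUnitaryGroup
  Summit.Ventures.HodgeRepro2.T5HeckeConjugationTransport Summit.Ventures.HodgeRepro2.T5RecordSatakeCell
  Summit.Ventures.HodgeRepro2.T5HeckeRecurrenceTransport Summit.Ventures.HodgeRepro2.T5RecordSatakeRecurrence
  Summit.Ventures.HodgeRepro2.T5RecordSatakeInert Summit.Ventures.HodgeRepro2.T5CMFieldSquareDatum
  Summit.Ventures.HodgeRepro2.T5InertGlobalPrime Summit.Ventures.HodgeRepro2.T5InertDegreePrinted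
  Summit.Ventures.HodgeRepro2.T5RecordSatakeRecurrenceIntrinsic

namespace Summit.Ventures.HodgeRepro2.T5RecordSatakeDegreeCells

section Record

variable (K : Type*) [Field K] [NumberField K] [IsCMField K]
variable (v : HeightOneSpectrum (𝓞 (maximalRealSubfield K))) (w : HeightOneSpectrum (𝓞 K))
  [w.asIdeal.LiesOver v.asIdeal]
  [IsDiscreteValuationRing (integralClosure (v.adicCompletionIntegers (maximalRealSubfield K)) (w.adicCompletion K))]
  [Finite (IsLocalRing.ResidueField (integralClosure (v.adicCompletionIntegers (maximalRealSubfield K))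
    (w.adicCompletion K)))]
  [IsFractionRing (integralClosure (v.adicCompletionIntegers (maximalRealSubfield K)) (w.adicCompletion K))
    (w.adicCompletion K)]
variable {θ : maximalRealSubfield K} {y : K}
  (hθ : algebraMap (maximalRealSubfield K) K θ = y ^ 2) (hy : complexConj K y ≠ y)
  (hsq : ¬ IsSquare (algebraMap (maximalRealSubfield K) (v.adicCompletion (maximalRealSubfield K)) θ))
  {ϖ : v.adicCompletionIntegers (maximalRealSubfield K)} (hϖ : Irreducible ϖ)
  (hinert : Irreducible (algebraMap (v.adicCompletionIntegers (maximalRealSubfield K)) (w.adicCompletionIntegers K) ϖ))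
variable {r : ℕ} (l : Fin r → 𝓞 K)

include hθ hy hsq hϖ hinert in
/-- **THE DEGREE OF A CONJUGATED CELL ON THE RECORD'S PAIR** (`n ≥ 1`): if `g ∈ U(1 ⊗ H)` maps to
`P · cell(ϖ', n) · P⁻¹ ∈ U(H_w)` for an integral change of basis `P` with `Pᴴ H_w P = J₃(u₀)`, then
`#(K_v g K_v / K_v) = (N(v)³ + 1) · N(v)^{4n−3}` — file 207's count on `U(J₃(u₀))`, carried along the conjugation
(file 243's `conjMulEquiv`, hyperspecial subgroups matched) and along file 231's `recordNonSplitEquiv'`. -/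
theorem ncard_orbit_record_of_coe_eq (hl : Submodule.span (𝓞 (maximalRealSubfield K)) (Set.range l) = ⊤)
    (he : v.asIdeal.ramificationIdx' w.asIdeal = 1) (H : Matrix (Fin 3) (Fin 3) K)
    (u₀ : (v.adicCompletionIntegers (maximalRealSubfield K))ˣ) (P : GL (Fin 3) (w.adicCompletion K))
    (n : ℕ) (hn : 1 ≤ n) :
    letI := tensorStarRing K v
    letI := starRingOfQuadratic (finrank_eq_two K v w hθ hy hsq)
      (localConj v w hθ.symm (span_pair_eq_top K hy) hsq (complexConj K))
      (localConj_ne_one v w hθ.symm (span_pair_eq_top K hy) hsq (complexConj K)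
        (complexConj_apply_eq_neg K hθ hy))
    ∀ g : ↥(formUnitaryGroup (tensorGram K v H)),
      P ∈ (Matrix.GeneralLinearGroup.map (algebraMap
        (integralClosure (v.adicCompletionIntegers (maximalRealSubfield K)) (w.adicCompletion K))
        (w.adicCompletion K))).range →
      (P : Matrix (Fin 3) (Fin 3) (w.adicCompletion K))ᴴ * H.map (algebraMap K (w.adicCompletion K)) * P =
        J3 (algebraMap (v.adicCompletionIntegers (maximalRealSubfield K)) (w.adicCompletion K)
          (u₀ : v.adicCompletionIntegers (maximalRealSubfield K))) →
      ((recordNonSplitEquiv' K v w hθ hy hsq H g : ↥(formUnitaryGroup (H.map (algebraMap K (w.adicCompletion K)))))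
        : GL (Fin 3) (w.adicCompletion K)) =
        P * cell (irreducible_uniformiser (map_maximalIdeal_integralClosure_eq_of_irreducible v w hϖ hinert) hϖ) n
          * P⁻¹ →
      (orbit (recordHyperspecial K v l H) (g : _ ⧸ recordHyperspecial K v l H)).ncard =
        (Ideal.absNorm v.asIdeal ^ 3 + 1) * Ideal.absNorm v.asIdeal ^ (4 * n - 3) := by
  letI := tensorStarRing K v
  letI := starRingOfQuadratic (finrank_eq_two K v w hθ hy hsq)
    (localConj v w hθ.symm (span_pair_eq_top K hy) hsq (complexConj K))
    (localConj_ne_one v w hθ.symm (span_pair_eq_top K hy) hsq (complexConj K)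
      (complexConj_apply_eq_neg K hθ hy))
  intro g hP hPHP himg
  -- the local data (as in files 232 / 244)
  have hst : ∀ x : w.adicCompletion K,
      star x = localConj v w hθ.symm (span_pair_eq_top K hy) hsq (complexConj K) x := fun x => by
    rw [star_p8_eq_star K v w hθ hy hsq]
    rfl
  -- the two spellings of `K_{H_w}`
  have hK : hyperspecialSubgroup (integralClosure (v.adicCompletionIntegers (maximalRealSubfield K))
      (w.adicCompletion K)) (H.map (algebraMap K (w.adicCompletion K))) =
      hyperspecialSubgroup (w.adicCompletionIntegers K) (H.map (algebraMap K (w.adicCompletion K))) :=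
    hyperspecialSubgroup_integralClosure_eq (R := v.adicCompletionIntegers (maximalRealSubfield K))
      (A := w.adicCompletionIntegers K) _
  have hKφ := mem_recordHyperspecial_iff_nonSplit K v w hθ hy hsq l hl H
  have hϖ' := irreducible_uniformiser (map_maximalIdeal_integralClosure_eq_of_irreducible v w hϖ hinert) hϖ
  have hs := star_algebraMap_of_star_eq (localConj v w hθ.symm (span_pair_eq_top K hy) hsq (complexConj K)) hst ϖ
  -- the image of `g` is the conjugate of the cell `aₙ ∈ U(J₃(u₀))`
  have hc2 : conjMulEquiv P hPHP (cellU hϖ' hs (algebraMap (v.adicCompletionIntegers (maximalRealSubfield K))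
      (w.adicCompletion K) (u₀ : v.adicCompletionIntegers (maximalRealSubfield K))) n) =
      recordNonSplitEquiv' K v w hθ hy hsq H g :=
    Subtype.ext ((conjMulEquiv_apply_coe P hPHP _).trans (by rw [coe_cellU]; exact himg.symm))
  -- file 207's count, carried along the conjugation and `recordNonSplitEquiv'`
  have hdeg0 := ncard_orbit_cellU_eq_adicCompletion v w
    (localConj v w hθ.symm (span_pair_eq_top K hy) hsq (complexConj K)) hst he (finrank_eq_two K v w hθ hy hsq)
    (localConj_ne_one v w hθ.symm (span_pair_eq_top K hy) hsq (complexConj K) (complexConj_apply_eq_neg K hθ hy))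
    hϖ hinert u₀ n hn
  have hc1 := ncard_orbit_eq_of_mulEquiv (conjMulEquiv P hPHP)
    (mem_hyperspecialSubgroup_conjMulEquiv_iff (R := integralClosure (v.adicCompletionIntegers (maximalRealSubfield K))
      (w.adicCompletion K)) P hPHP hP)
    (cellU hϖ' hs (algebraMap (v.adicCompletionIntegers (maximalRealSubfield K)) (w.adicCompletion K)
      (u₀ : v.adicCompletionIntegers (maximalRealSubfield K))) n)
  have hc3 := ncard_orbit_eq_of_eq hK (recordNonSplitEquiv' K v w hθ hy hsq H g)
  have hc4 := ncard_orbit_eq_of_mulEquiv (recordNonSplitEquiv' K v w hθ hy hsq H) hKφ g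
  rw [hc4, ← hc3, ← hc2, ← hc1, hdeg0]

omit [Finite (IsLocalRing.ResidueField (integralClosure (v.adicCompletionIntegers (maximalRealSubfield K))
  (w.adicCompletion K)))] in
include hθ hy hsq hϖ hinert in
/-- **THE DEGREE OF THE TRIVIAL CELL ON THE RECORD'S PAIR**: an element of `U(1 ⊗ H)` mapping to
`P · cell(ϖ', 0) · P⁻¹` has a double coset of exactly one left coset (file 203's `ncard_orbit_cellU_zero`, carried
along the same isomorphisms). -/
theorem ncard_orbit_record_of_coe_eq_zero (hl : Submodule.span (𝓞 (maximalRealSubfield K)) (Set.range l) = ⊤)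
    (H : Matrix (Fin 3) (Fin 3) K)
    (u₀ : (v.adicCompletionIntegers (maximalRealSubfield K))ˣ) (P : GL (Fin 3) (w.adicCompletion K)) :
    letI := tensorStarRing K v
    letI := starRingOfQuadratic (finrank_eq_two K v w hθ hy hsq)
      (localConj v w hθ.symm (span_pair_eq_top K hy) hsq (complexConj K))
      (localConj_ne_one v w hθ.symm (span_pair_eq_top K hy) hsq (complexConj K)
        (complexConj_apply_eq_neg K hθ hy))
    ∀ g : ↥(formUnitaryGroup (tensorGram K v H)),
      P ∈ (Matrix.GeneralLinearGroup.map (algebraMap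
        (integralClosure (v.adicCompletionIntegers (maximalRealSubfield K)) (w.adicCompletion K))
        (w.adicCompletion K))).range →
      (P : Matrix (Fin 3) (Fin 3) (w.adicCompletion K))ᴴ * H.map (algebraMap K (w.adicCompletion K)) * P =
        J3 (algebraMap (v.adicCompletionIntegers (maximalRealSubfield K)) (w.adicCompletion K)
          (u₀ : v.adicCompletionIntegers (maximalRealSubfield K))) →
      ((recordNonSplitEquiv' K v w hθ hy hsq H g : ↥(formUnitaryGroup (H.map (algebraMap K (w.adicCompletion K)))))
        : GL (Fin 3) (w.adicCompletion K)) =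
        P * cell (irreducible_uniformiser (map_maximalIdeal_integralClosure_eq_of_irreducible v w hϖ hinert) hϖ) 0
          * P⁻¹ →
      (orbit (recordHyperspecial K v l H) (g : _ ⧸ recordHyperspecial K v l H)).ncard = 1 := by
  letI := tensorStarRing K v
  letI := starRingOfQuadratic (finrank_eq_two K v w hθ hy hsq)
    (localConj v w hθ.symm (span_pair_eq_top K hy) hsq (complexConj K))
    (localConj_ne_one v w hθ.symm (span_pair_eq_top K hy) hsq (complexConj K)
      (complexConj_apply_eq_neg K hθ hy))
  intro g hP hPHP himg
  have hst : ∀ x : w.adicCompletion K,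
      star x = localConj v w hθ.symm (span_pair_eq_top K hy) hsq (complexConj K) x := fun x => by
    rw [star_p8_eq_star K v w hθ hy hsq]
    rfl
  have hK : hyperspecialSubgroup (integralClosure (v.adicCompletionIntegers (maximalRealSubfield K))
      (w.adicCompletion K)) (H.map (algebraMap K (w.adicCompletion K))) =
      hyperspecialSubgroup (w.adicCompletionIntegers K) (H.map (algebraMap K (w.adicCompletion K))) :=
    hyperspecialSubgroup_integralClosure_eq (R := v.adicCompletionIntegers (maximalRealSubfield K))
      (A := w.adicCompletionIntegers K) _
  have hKφ := mem_recordHyperspecial_iff_nonSplit K v w hθ hy hsq l hl H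
  have hϖ' := irreducible_uniformiser (map_maximalIdeal_integralClosure_eq_of_irreducible v w hϖ hinert) hϖ
  have hs := star_algebraMap_of_star_eq (localConj v w hθ.symm (span_pair_eq_top K hy) hsq (complexConj K)) hst ϖ
  have hc2 : conjMulEquiv P hPHP (cellU hϖ' hs (algebraMap (v.adicCompletionIntegers (maximalRealSubfield K))
      (w.adicCompletion K) (u₀ : v.adicCompletionIntegers (maximalRealSubfield K))) 0) =
      recordNonSplitEquiv' K v w hθ hy hsq H g :=
    Subtype.ext ((conjMulEquiv_apply_coe P hPHP _).trans (by rw [coe_cellU]; exact himg.symm))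
  have hdeg0 := ncard_orbit_cellU_zero (R := integralClosure (v.adicCompletionIntegers (maximalRealSubfield K))
    (w.adicCompletion K)) (algebraMap (v.adicCompletionIntegers (maximalRealSubfield K)) (w.adicCompletion K)
      (u₀ : v.adicCompletionIntegers (maximalRealSubfield K))) hϖ' hs
  have hc1 := ncard_orbit_eq_of_mulEquiv (conjMulEquiv P hPHP)
    (mem_hyperspecialSubgroup_conjMulEquiv_iff (R := integralClosure (v.adicCompletionIntegers (maximalRealSubfield K))
      (w.adicCompletion K)) P hPHP hP)
    (cellU hϖ' hs (algebraMap (v.adicCompletionIntegers (maximalRealSubfield K)) (w.adicCompletion K)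
      (u₀ : v.adicCompletionIntegers (maximalRealSubfield K))) 0)
  have hc3 := ncard_orbit_eq_of_eq hK (recordNonSplitEquiv' K v w hθ hy hsq H g)
  have hc4 := ncard_orbit_eq_of_mulEquiv (recordNonSplitEquiv' K v w hθ hy hsq H) hKφ g
  rw [hc4, ← hc3, ← hc2, ← hc1, hdeg0]

include hθ hy hsq hϖ hinert in
/-- **THE CELLS OF THE RECORD'S PAIR WITH THEIR DEGREES AND THEIR RECURSION** (file 247 + the two theorems above):
`u₀`, `P` with `Pᴴ H_w P = J₃(u₀)`, cells `gₙ ↦ P · cell(ϖ, n) · P⁻¹`, `deg Tₙ = #(K_v gₙ K_v / K_v) =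
(N(v)³ + 1) N(v)^{4n−3}` for `n ≥ 1`, `deg T₀ = 1`, and the tree recursion — rows 6–9 / 9′ and 11 / 11′ of the
Satake memo, as printed, for every cell, on the record's own pair. -/
theorem exists_cells_three_term_and_ncard_record (k : Type*) [Field k] [CharZero k]
    (hl : Submodule.span (𝓞 (maximalRealSubfield K)) (Set.range l) = ⊤)
    (he : v.asIdeal.ramificationIdx' w.asIdeal = 1)
    {H : Matrix (Fin 3) (Fin 3) K} (hH : H.IsHermitian) (hdet : IsUnit H.det) (hgood : w ∉ badSet H) :
    letI := tensorStarRing K v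
    letI := starRingOfQuadratic (finrank_eq_two K v w hθ hy hsq)
      (localConj v w hθ.symm (span_pair_eq_top K hy) hsq (complexConj K))
      (localConj_ne_one v w hθ.symm (span_pair_eq_top K hy) hsq (complexConj K)
        (complexConj_apply_eq_neg K hθ hy))
    ∃ (u₀ : (v.adicCompletionIntegers (maximalRealSubfield K))ˣ) (P : GL (Fin 3) (w.adicCompletion K))
      (g : ℕ → ↥(formUnitaryGroup (tensorGram K v H))),
      P ∈ (Matrix.GeneralLinearGroup.map (algebraMap
        (integralClosure (v.adicCompletionIntegers (maximalRealSubfield K)) (w.adicCompletion K))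
        (w.adicCompletion K))).range ∧
      (P : Matrix (Fin 3) (Fin 3) (w.adicCompletion K))ᴴ * H.map (algebraMap K (w.adicCompletion K)) * P =
        J3 (algebraMap (v.adicCompletionIntegers (maximalRealSubfield K)) (w.adicCompletion K)
          (u₀ : v.adicCompletionIntegers (maximalRealSubfield K))) ∧
      (∀ n, ((recordNonSplitEquiv' K v w hθ hy hsq H (g n) :
          ↥(formUnitaryGroup (H.map (algebraMap K (w.adicCompletion K))))) : GL (Fin 3) (w.adicCompletion K)) =
        P * cell (irreducible_uniformiser (map_maximalIdeal_integralClosure_eq_of_irreducible v w hϖ hinert) hϖ) n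
          * P⁻¹) ∧
      (∀ n, 1 ≤ n → (orbit (recordHyperspecial K v l H) (g n : _ ⧸ recordHyperspecial K v l H)).ncard =
        (Ideal.absNorm v.asIdeal ^ 3 + 1) * Ideal.absNorm v.asIdeal ^ (4 * n - 3)) ∧
      (orbit (recordHyperspecial K v l H) (g 0 : _ ⧸ recordHyperspecial K v l H)).ncard = 1 ∧
      ∃ hfin : ∀ n, Finite (orbit (recordHyperspecial K v l H) (g n : _ ⧸ recordHyperspecial K v l H)),
        (∀ n, letI := hfin 1; letI := hfin (n + 1 + 1); letI := hfin (n + 1 + 1 + 1); letI := hfin (n + 1);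
          doubleCosetOp k (recordHyperspecial K v l H) (g 1) *
              doubleCosetOp k (recordHyperspecial K v l H) (g (n + 1 + 1)) =
            doubleCosetOp k (recordHyperspecial K v l H) (g (n + 1 + 1 + 1)) +
              ((Ideal.absNorm v.asIdeal : k) - 1) • doubleCosetOp k (recordHyperspecial K v l H) (g (n + 1 + 1)) +
              (Ideal.absNorm v.asIdeal : k) ^ 4 • doubleCosetOp k (recordHyperspecial K v l H) (g (n + 1))) ∧
        (letI := hfin 1; letI := hfin (0 + 1); letI := hfin (0 + 1 + 1); letI := hfin 0;
          doubleCosetOp k (recordHyperspecial K v l H) (g 1) *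
              doubleCosetOp k (recordHyperspecial K v l H) (g (0 + 1)) =
            doubleCosetOp k (recordHyperspecial K v l H) (g (0 + 1 + 1)) +
              ((Ideal.absNorm v.asIdeal : k) - 1) • doubleCosetOp k (recordHyperspecial K v l H) (g (0 + 1)) +
              ((Ideal.absNorm v.asIdeal : k) ^ 4 + Ideal.absNorm v.asIdeal) •
                doubleCosetOp k (recordHyperspecial K v l H) (g 0)) :=
  (exists_cells_three_term_record K v w hθ hy hsq hϖ hinert l k hl he hH hdet hgood).elim fun u₀ h =>
    h.elim fun P h => h.elim fun g h => h.elim fun hP h => h.elim fun hPHP h => h.elim fun himg h =>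
      ⟨u₀, P, g, hP, hPHP, himg,
        fun n hn => ncard_orbit_record_of_coe_eq K v w hθ hy hsq hϖ hinert l hl he H u₀ P n hn (g n) hP hPHP
          (himg n),
        ncard_orbit_record_of_coe_eq_zero K v w hθ hy hsq hϖ hinert l hl H u₀ P (g 0) hP hPHP (himg 0), h⟩

end Record

section StaysPrime

variable (K : Type*) [Field K] [NumberField K] [IsCMField K]
variable (v : HeightOneSpectrum (𝓞 (maximalRealSubfield K))) (w : HeightOneSpectrum (𝓞 K))
  [w.asIdeal.LiesOver v.asIdeal]
variable {θ : maximalRealSubfield K} {y : K}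
  (hθ : algebraMap (maximalRealSubfield K) K θ = y ^ 2) (hy : complexConj K y ≠ y)
  (hmap : Ideal.map (algebraMap (𝓞 (maximalRealSubfield K)) (𝓞 K)) v.asIdeal = w.asIdeal)
variable {r : ℕ} (l : Fin r → 𝓞 K)

include hθ hy hmap in
/-- **THE CELLS, THEIR DEGREES AND THEIR RECURSION AT EVERY PLACE THAT STAYS PRIME**: the theorem above with its
local hypotheses discharged by file 233's method (`e(w/v) = 1` from seat p8's `ramificationIdx'_eq_one_of_staysPrime`);
the cells are those of a uniformiser `ϖ'` of `𝒪_{E_v}`. -/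
theorem exists_cells_three_term_and_ncard_record_of_staysPrime (k : Type*) [Field k] [CharZero k]
    (hl : Submodule.span (𝓞 (maximalRealSubfield K)) (Set.range l) = ⊤)
    {H : Matrix (Fin 3) (Fin 3) K} (hH : H.IsHermitian) (hdet : IsUnit H.det) (hgood : w ∉ badSet H) :
    letI := tensorStarRing K v
    letI := starRingOfQuadratic (finrank_eq_two K v w hθ hy (not_isSquare_of_staysPrime K v w hθ hy hmap))
      (localConj v w hθ.symm (span_pair_eq_top K hy) (not_isSquare_of_staysPrime K v w hθ hy hmap) (complexConj K))
      (localConj_ne_one v w hθ.symm (span_pair_eq_top K hy) (not_isSquare_of_staysPrime K v w hθ hy hmap)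
        (complexConj K) (complexConj_apply_eq_neg K hθ hy))
    haveI : IsFractionRing (integralClosure (v.adicCompletionIntegers (maximalRealSubfield K)) (w.adicCompletion K))
      (w.adicCompletion K) :=
      integralClosure.isFractionRing_of_finite_extension (v.adicCompletion (maximalRealSubfield K))
        (w.adicCompletion K)
    ∃ (u₀ : (v.adicCompletionIntegers (maximalRealSubfield K))ˣ) (P : GL (Fin 3) (w.adicCompletion K))
      (g : ℕ → ↥(formUnitaryGroup (tensorGram K v H))),
      P ∈ (Matrix.GeneralLinearGroup.map (algebraMap
        (integralClosure (v.adicCompletionIntegers (maximalRealSubfield K)) (w.adicCompletion K))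
        (w.adicCompletion K))).range ∧
      (P : Matrix (Fin 3) (Fin 3) (w.adicCompletion K))ᴴ * H.map (algebraMap K (w.adicCompletion K)) * P =
        J3 (algebraMap (v.adicCompletionIntegers (maximalRealSubfield K)) (w.adicCompletion K)
          (u₀ : v.adicCompletionIntegers (maximalRealSubfield K))) ∧
      (∃ (ϖ' : integralClosure (v.adicCompletionIntegers (maximalRealSubfield K)) (w.adicCompletion K))
        (hϖ' : Irreducible ϖ'), ∀ n,
        ((recordNonSplitEquiv' K v w hθ hy (not_isSquare_of_staysPrime K v w hθ hy hmap) H (g n) :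
          ↥(formUnitaryGroup (H.map (algebraMap K (w.adicCompletion K))))) : GL (Fin 3) (w.adicCompletion K)) =
          P * cell hϖ' n * P⁻¹) ∧
      (∀ n, 1 ≤ n → (orbit (recordHyperspecial K v l H) (g n : _ ⧸ recordHyperspecial K v l H)).ncard =
        (Ideal.absNorm v.asIdeal ^ 3 + 1) * Ideal.absNorm v.asIdeal ^ (4 * n - 3)) ∧
      (orbit (recordHyperspecial K v l H) (g 0 : _ ⧸ recordHyperspecial K v l H)).ncard = 1 ∧
      ∃ hfin : ∀ n, Finite (orbit (recordHyperspecial K v l H) (g n : _ ⧸ recordHyperspecial K v l H)),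
        (∀ n, letI := hfin 1; letI := hfin (n + 1 + 1); letI := hfin (n + 1 + 1 + 1); letI := hfin (n + 1);
          doubleCosetOp k (recordHyperspecial K v l H) (g 1) *
              doubleCosetOp k (recordHyperspecial K v l H) (g (n + 1 + 1)) =
            doubleCosetOp k (recordHyperspecial K v l H) (g (n + 1 + 1 + 1)) +
              ((Ideal.absNorm v.asIdeal : k) - 1) • doubleCosetOp k (recordHyperspecial K v l H) (g (n + 1 + 1)) +
              (Ideal.absNorm v.asIdeal : k) ^ 4 • doubleCosetOp k (recordHyperspecial K v l H) (g (n + 1))) ∧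
        (letI := hfin 1; letI := hfin (0 + 1); letI := hfin (0 + 1 + 1); letI := hfin 0;
          doubleCosetOp k (recordHyperspecial K v l H) (g 1) *
              doubleCosetOp k (recordHyperspecial K v l H) (g (0 + 1)) =
            doubleCosetOp k (recordHyperspecial K v l H) (g (0 + 1 + 1)) +
              ((Ideal.absNorm v.asIdeal : k) - 1) • doubleCosetOp k (recordHyperspecial K v l H) (g (0 + 1)) +
              ((Ideal.absNorm v.asIdeal : k) ^ 4 + Ideal.absNorm v.asIdeal) •
                doubleCosetOp k (recordHyperspecial K v l H) (g 0)) :=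
  haveI := isDiscreteValuationRing_integralClosure_adicCompletion v w
  haveI := finite_residueField_integralClosure_adicCompletion v w
  haveI : IsFractionRing (integralClosure (v.adicCompletionIntegers (maximalRealSubfield K)) (w.adicCompletion K))
      (w.adicCompletion K) :=
    integralClosure.isFractionRing_of_finite_extension (v.adicCompletion (maximalRealSubfield K)) (w.adicCompletion K)
  (exists_irreducible_and_irreducible_algebraMap_of_staysPrime K v w hmap).elim fun _ h =>
    (exists_cells_three_term_and_ncard_record K v w hθ hy (not_isSquare_of_staysPrime K v w hθ hy hmap) h.1 h.2 l k
      hl (ramificationIdx'_eq_one_of_staysPrime v w hmap) hH hdet hgood).elim fun u₀ h1 => h1.elim fun P h2 =>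
      h2.elim fun g h3 => ⟨u₀, P, g, h3.1, h3.2.1, ⟨_, irreducible_uniformiser
        (map_maximalIdeal_integralClosure_eq_of_irreducible v w h.1 h.2) h.1, h3.2.2.1⟩, h3.2.2.2.1, h3.2.2.2.2.1,
        h3.2.2.2.2.2⟩

omit hθ hy in
include hmap in
/-- **THE DEGREES AND THE RECURSION AT EVERY PLACE THAT STAYS PRIME, WITH NO AUXILIARY DATUM**: some cells
`gₙ ∈ U(1 ⊗ H)` with finite double cosets have `deg Tₙ = (N(v)³ + 1) N(v)^{4n−3}` (`n ≥ 1`), `deg T₀ = 1`, and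
characteristic functions `Tₙ` satisfying the tree recursion (the datum of file 235 chosen inside the proof). -/
theorem exists_cells_three_term_and_ncard_record_of_staysPrime' (k : Type*) [Field k] [CharZero k]
    (hl : Submodule.span (𝓞 (maximalRealSubfield K)) (Set.range l) = ⊤)
    {H : Matrix (Fin 3) (Fin 3) K} (hH : H.IsHermitian) (hdet : IsUnit H.det) (hgood : w ∉ badSet H) :
    ∃ g : ℕ → (letI := tensorStarRing K v; ↥(formUnitaryGroup (tensorGram K v H))),
      (∀ n, 1 ≤ n → (orbit (recordHyperspecial K v l H) (g n : _ ⧸ recordHyperspecial K v l H)).ncard =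
        (Ideal.absNorm v.asIdeal ^ 3 + 1) * Ideal.absNorm v.asIdeal ^ (4 * n - 3)) ∧
      (orbit (recordHyperspecial K v l H) (g 0 : _ ⧸ recordHyperspecial K v l H)).ncard = 1 ∧
      ∃ hfin : ∀ n, Finite (orbit (recordHyperspecial K v l H) (g n : _ ⧸ recordHyperspecial K v l H)),
        (∀ n, letI := hfin 1; letI := hfin (n + 1 + 1); letI := hfin (n + 1 + 1 + 1); letI := hfin (n + 1);
          doubleCosetOp k (recordHyperspecial K v l H) (g 1) *
              doubleCosetOp k (recordHyperspecial K v l H) (g (n + 1 + 1)) =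
            doubleCosetOp k (recordHyperspecial K v l H) (g (n + 1 + 1 + 1)) +
              ((Ideal.absNorm v.asIdeal : k) - 1) • doubleCosetOp k (recordHyperspecial K v l H) (g (n + 1 + 1)) +
              (Ideal.absNorm v.asIdeal : k) ^ 4 • doubleCosetOp k (recordHyperspecial K v l H) (g (n + 1))) ∧
        (letI := hfin 1; letI := hfin (0 + 1); letI := hfin (0 + 1 + 1); letI := hfin 0;
          doubleCosetOp k (recordHyperspecial K v l H) (g 1) *
              doubleCosetOp k (recordHyperspecial K v l H) (g (0 + 1)) =
            doubleCosetOp k (recordHyperspecial K v l H) (g (0 + 1 + 1)) +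
              ((Ideal.absNorm v.asIdeal : k) - 1) • doubleCosetOp k (recordHyperspecial K v l H) (g (0 + 1)) +
              ((Ideal.absNorm v.asIdeal : k) ^ 4 + Ideal.absNorm v.asIdeal) •
                doubleCosetOp k (recordHyperspecial K v l H) (g 0)) :=
  (exists_sq_eq_and_complexConj_ne K).elim fun _ h => h.elim fun _ h =>
    (exists_cells_three_term_and_ncard_record_of_staysPrime K v w h.1 h.2 hmap l k hl hH hdet hgood).elim
      fun _ h1 => h1.elim fun _ h2 => h2.elim fun g h3 => ⟨g, h3.2.2.2.1, h3.2.2.2.2.1, h3.2.2.2.2.2⟩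

end StaysPrime

end Summit.Ventures.HodgeRepro2.T5RecordSatakeDegreeCells
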